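import Literature.NumberTheory.LFunctions.FujiiMeanSquare
import Literature.NumberTheory.LFunctions.SelbergFujiiMoments
import Summits.RiemannHypothesis.RiemannHypothesis.Theorems.Splittings.ZdLocalReferencePins
import HarnessLib

/-!
# ZdReferencePinRoughness — E4, the INCREMENT (ROUGHNESS) FLOOR for reference pins of `S(t)` (lane (x-f); zd-neg g11 `SketchG11.lean` verbatim, title line only retitled)

Card `run/shared/lean/pub/rh-split/cards/SPLIT-zd-neg.md`, GEN-11 addendum (row N67 sharpened, census R65, catalogue B12 scope⁺).
Brief sha16 f79c5f09d8bcb036.  Scratch kernel in TREE-READY shape (namespace = the landed `…Splittings.ZdPrimePin` of lane (x-e); `RefPinR` / `RefPin` are the TREE decls of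
`ZdLocalReferencePins.lean` 064d58168d65d053 / `ZdContinuousReferencePins.lean` 13a2112d223efe0b); tree-only imports; standard axioms (checked).

CONTENT.  g10 (`SketchG10.lean` 29368ce59f30369a, lanes (x-e)) proved: a reference pin `|S(t) − R(t)| < r` above a height is a
VALID splitting partner of FIN for every reference `R` continuous from the left (r ≤ 1), and is REFUTED unconditionally for every
reference dominated on ONE side by `ε · (log t)^{1/3} (log log t)^{-7/3}` (Selberg Ω± with its rate) and for every fixed-scale
prime / Dirichlet-polynomial reference; the residue was described in prose as «R must oscillate with S».  THIS FILE adds the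
orthogonal unconditional engine E4: Fujii's increment law `∫_T^{2T} (S(t+h) − S(t))² dt = π⁻² T log(3 + h log T) + O(T √log(3 + h log T))`
(`0 ≤ h ≤ 1`; tree theorems `FujiiMeanSquare.meanSquare_block_twoSided_of_approxFormula` ∘ `SelbergMeanSquare.approxFormula_meanSquare_of_zeroDensity`
∘ `SelbergDensity.selberg_zeroDensity_near_half`, all PROVED) refutes every reference that is SLOWLY VARYING at some scale `h_T → 0` with
`h_T log T → ∞` — in particular every reference Lipschitz on late windows with constant `o(log T)`, of ANY amplitude and sign pattern
(e.g. `√(log t) · sin t`, which no g10 engine reaches).  Residue (paper): the reference must reproduce Fujii's law at every scale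
`h ∈ [C / log T, 1]` — be exactly as rough as `S` down to the mean spacing; the co-growing prime reference of N68 does (consistency with R60).

§1 the increment transfer for the tree's `RefPinR` · §2 Fujii's law on dyadic blocks (composition of tree theorems) · §3 E4 core
inequality `fujii_floor_of_refPinR` and the qualitative kill `not_refPinR_of_slow` · §4 Lipschitz corollary `not_refPinR_of_lipschitz` and the unit-scale corollary `not_refPinR_of_bounded_unit_incr` ·
§5 amplitude-modulated oscillations `A(t)·sin t`, `A = o(log)` (`not_refPinR_amp_mul_sin`; instances `√(log t)·sin t`, `(log t)^{1/3}·sin t` = the g11-probed `RefPinOscH0`), outside every g10 engine · §6 read-backs for the radius-1 pin `RefPin` of `ZdContinuousReferencePins`.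

HONEST LABEL: «SPLITTING SEARCH over kernel-typed RH-EQUIVALENCES; a splitting A ∧ B ⟹ RH is CONDITIONAL bookkeeping unless A and B are both proved; nothing here bears on the truth of RH.»
-/
set_option linter.dupNamespace false

noncomputable section

open Filter Set MeasureTheory
open scoped Real Topology
open Literature.NumberTheory.LFunctions

namespace Summit.RiemannHypothesis.RiemannHypothesis.Theorems.Splittings.ZdPrimePin

/-! ## §1 Increment transfer for radius-`r` pins (`RefPinR H r R : ∀ t ≥ H, |S(t) − R(t)| < r`, tree decl) -/

/-- A pin transfers increments: `|S(t') − S(t)| < |R(t') − R(t)| + 2r` for `t, t' ≥ H`. -/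
theorem abs_sub_lt_of_refPinR {H r : ℝ} {R : ℝ → ℝ} (h : RefPinR H r R) {t t' : ℝ} (ht : H ≤ t)
    (ht' : H ≤ t') : |zetaArgS t' - zetaArgS t| < |R t' - R t| + 2 * r := by
  have h1 := h t ht
  have h2 := h t' ht'
  rw [abs_lt] at h1 h2
  have h3 := le_abs_self (R t' - R t)
  have h4 := neg_abs_le (R t' - R t)
  rw [abs_lt]
  constructor <;> linarith

/-! ## §2 Fujii's increment law on dyadic blocks (tree theorems composed; unconditional) -/

/-- `|∫_T^{2T} (S(t+h) − S(t))² dt − π⁻² T log(3 + h log T)| ≤ A T √log(3 + h log T)` for `T ≥ T₁`, `0 ≤ h ≤ 1`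
(Fujii / Titchmarsh (9.25.2) on blocks, from Selberg's mean-value approximate formula and Selberg's zero-density theorem, both
PROVED in the tree). -/
theorem fujii_block : ∃ A : ℝ, ∃ T₁ : ℝ, 1 ≤ T₁ ∧ ∀ T : ℝ, T₁ ≤ T → ∀ h : ℝ, 0 ≤ h → h ≤ 1 →
    |(∫ t in T..2 * T, (zetaArgS (t + h) - zetaArgS t) ^ 2) -
        T * Real.log (3 + h * Real.log T) / π ^ 2| ≤
      A * (T * Real.sqrt (Real.log (3 + h * Real.log T))) :=
  FujiiMeanSquare.meanSquare_block_twoSided_of_approxFormula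
    (SelbergMeanSquare.approxFormula_meanSquare_of_zeroDensity
      SelbergDensity.selberg_zeroDensity_near_half)

/-! ## §3 E4: the increment floor -/

/-- **E4, core inequality.** If `R` pins `S` within `r` above `H`, and on the block `[T, 2T]` (`T ≥ T₁, H, 0`) the
`h`-increments of `R` are bounded by `ω` (`0 ≤ h ≤ 1`), then Fujii's main term is capped:
`π⁻² T ℓ − A T √ℓ ≤ (ω + 2r)² T`, `ℓ = log(3 + h log T)`. -/
theorem fujii_floor_of_refPinR {A T₁ : ℝ}
    (hF : ∀ T : ℝ, T₁ ≤ T → ∀ h : ℝ, 0 ≤ h → h ≤ 1 →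
      |(∫ t in T..2 * T, (zetaArgS (t + h) - zetaArgS t) ^ 2) -
          T * Real.log (3 + h * Real.log T) / π ^ 2| ≤
        A * (T * Real.sqrt (Real.log (3 + h * Real.log T))))
    {H r : ℝ} {R : ℝ → ℝ} (hpin : RefPinR H r R) {T h ω : ℝ} (hT₁ : T₁ ≤ T) (hHT : H ≤ T)
    (hT0 : 0 ≤ T) (hh : 0 ≤ h) (hh1 : h ≤ 1) (hω : ∀ t ∈ Icc T (2 * T), |R (t + h) - R t| ≤ ω) :
    T * Real.log (3 + h * Real.log T) / π ^ 2 -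
        A * (T * Real.sqrt (Real.log (3 + h * Real.log T))) ≤ (ω + 2 * r) ^ 2 * T := by
  have hpt : ∀ t ∈ Icc T (2 * T), (zetaArgS (t + h) - zetaArgS t) ^ 2 ≤ (ω + 2 * r) ^ 2 := by
    intro t ht
    have h1 : |zetaArgS (t + h) - zetaArgS t| < |R (t + h) - R t| + 2 * r :=
      abs_sub_lt_of_refPinR hpin (hHT.trans ht.1) (hHT.trans (ht.1.trans (by linarith)))
    have h2 : |zetaArgS (t + h) - zetaArgS t| ≤ ω + 2 * r := (h1.trans_le (by linarith [hω t ht])).le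
    calc (zetaArgS (t + h) - zetaArgS t) ^ 2 = |zetaArgS (t + h) - zetaArgS t| ^ 2 := (sq_abs _).symm
      _ ≤ (ω + 2 * r) ^ 2 := pow_le_pow_left₀ (abs_nonneg _) h2 2
  have hint : IntervalIntegrable (fun t ↦ (zetaArgS (t + h) - zetaArgS t) ^ 2) volume T (2 * T) :=
    (SelbergFujii.intervalIntegrable_zetaArgS_sub_pow hT0 hh hh1 2).mono_set (by
      rw [uIcc_of_le (by linarith), uIcc_of_le (by linarith)]
      exact Icc_subset_Icc hT0 le_rfl)
  have hI : (∫ t in T..2 * T, (zetaArgS (t + h) - zetaArgS t) ^ 2) ≤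
      ∫ _t in T..2 * T, (ω + 2 * r) ^ 2 :=
    intervalIntegral.integral_mono_on (by linarith) hint intervalIntegrable_const fun t ht ↦ hpt t ht
  rw [intervalIntegral.integral_const, smul_eq_mul] at hI
  have e : (2 * T - T) * (ω + 2 * r) ^ 2 = (ω + 2 * r) ^ 2 * T := by ring
  rw [e] at hI
  have hF' := hF T hT₁ h hh hh1
  rw [abs_le] at hF'
  linarith [hF'.1]

/-- Growth: `ℓ / π² − A √ℓ` eventually exceeds any `B`. -/
theorem exists_floor_gt (A B : ℝ) : ∃ L : ℝ, 0 ≤ L ∧ ∀ ℓ : ℝ, L ≤ ℓ → B < ℓ / π ^ 2 - A * Real.sqrt ℓ := by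
  have hπ : 0 < π := Real.pi_pos
  refine ⟨max (4 * π ^ 4 * (max A 0) ^ 2) (2 * π ^ 2 * (|B| + 1)), by positivity, fun ℓ hℓ ↦ ?_⟩
  have hℓ1 : 4 * π ^ 4 * (max A 0) ^ 2 ≤ ℓ := (le_max_left _ _).trans hℓ
  have hℓ2 : 2 * π ^ 2 * (|B| + 1) ≤ ℓ := (le_max_right _ _).trans hℓ
  have hℓ0 : 0 ≤ ℓ := le_trans (by positivity) hℓ2
  have hs : Real.sqrt ℓ ^ 2 = ℓ := Real.sq_sqrt hℓ0
  have hs0 : 0 ≤ Real.sqrt ℓ := Real.sqrt_nonneg ℓ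
  have hm : 0 ≤ max A 0 := le_max_right _ _
  have h1 : 2 * π ^ 2 * max A 0 ≤ Real.sqrt ℓ := by
    rw [← Real.sqrt_sq (by positivity : 0 ≤ 2 * π ^ 2 * max A 0)]
    exact Real.sqrt_le_sqrt (by nlinarith [hℓ1])
  have h2 : A * Real.sqrt ℓ ≤ ℓ / (2 * π ^ 2) := by
    calc A * Real.sqrt ℓ ≤ max A 0 * Real.sqrt ℓ := mul_le_mul_of_nonneg_right (le_max_left _ _) hs0
      _ ≤ Real.sqrt ℓ * Real.sqrt ℓ / (2 * π ^ 2) := by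
          rw [le_div_iff₀ (by positivity)]
          calc max A 0 * Real.sqrt ℓ * (2 * π ^ 2) = (2 * π ^ 2 * max A 0) * Real.sqrt ℓ := by ring
            _ ≤ Real.sqrt ℓ * Real.sqrt ℓ := mul_le_mul_of_nonneg_right h1 hs0
      _ = ℓ / (2 * π ^ 2) := by rw [← sq, hs]
  have h3 : |B| + 1 ≤ ℓ / (2 * π ^ 2) := by rw [le_div_iff₀ (by positivity)]; linarith
  have h4 : ℓ / π ^ 2 = ℓ / (2 * π ^ 2) + ℓ / (2 * π ^ 2) := by ring
  linarith [le_abs_self B]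

/-- **E4 — the increment (roughness) floor, UNCONDITIONAL.**  A reference whose `h`-increments stay bounded by one fixed `c` on
arbitrarily late blocks `[T, 2T]`, at scales `h = h_T ∈ [0, 1]` with `log(3 + h_T log T)` unbounded, pins `S` at NO radius above NO
height.  (Fujii: `S(t+h) − S(t)` has mean square `≍ T log(h log T)` on `[T, 2T]`; the pin would cap it by `(c + 2r)² T`.) -/
theorem not_refPinR_of_slow {R : ℝ → ℝ} {c : ℝ}
    (hslow : ∀ K : ℝ, ∃ T h : ℝ, K ≤ T ∧ 0 ≤ h ∧ h ≤ 1 ∧ K ≤ Real.log (3 + h * Real.log T) ∧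
      ∀ t ∈ Icc T (2 * T), |R (t + h) - R t| ≤ c) (H r : ℝ) : ¬ RefPinR H r R := by
  intro hpin
  obtain ⟨A, T₁, hT₁, hF⟩ := fujii_block
  obtain ⟨L, hL0, hL⟩ := exists_floor_gt A ((c + 2 * r) ^ 2)
  obtain ⟨T, h, hKT, hh, hh1, hKℓ, hω⟩ := hslow (max (max T₁ H) (max L 1))
  have hT₁T : T₁ ≤ T := le_trans ((le_max_left _ _).trans (le_max_left _ _)) hKT
  have hHT : H ≤ T := le_trans ((le_max_right _ _).trans (le_max_left _ _)) hKT
  have hT1 : 1 ≤ T := le_trans ((le_max_right _ _).trans (le_max_right _ _)) hKT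
  have hLℓ : L ≤ Real.log (3 + h * Real.log T) :=
    le_trans ((le_max_left _ _).trans (le_max_right _ _)) hKℓ
  have key := fujii_floor_of_refPinR hF hpin hT₁T hHT (by linarith) hh hh1 hω
  have hgt := hL _ hLℓ
  set ℓ := Real.log (3 + h * Real.log T)
  have e : T * ℓ / π ^ 2 - A * (T * Real.sqrt ℓ) = T * (ℓ / π ^ 2 - A * Real.sqrt ℓ) := by ring
  rw [e] at key
  have hTpos : 0 < T := by linarith
  have : ℓ / π ^ 2 - A * Real.sqrt ℓ ≤ (c + 2 * r) ^ 2 :=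
    le_of_mul_le_mul_left (key.trans_eq (by ring)) hTpos
  exact absurd hgt (not_lt.2 this)

/-! ## §4 Every eventually Lipschitz reference is refuted (any constant, any amplitude, any sign pattern) -/

/-- **E4, Lipschitz form.**  If `|R(t') − R(t)| ≤ L (t' − t)` for `T₀ ≤ t ≤ t'`, then `R` pins `S` at no radius above no height —
this covers unbounded two-signed references such as `t · sin(log t)` or `√t · sin √t`, which no one-sided (Ω±) engine reaches. -/
theorem not_refPinR_of_lipschitz {R : ℝ → ℝ} {L T₀ : ℝ} (hL : 0 ≤ L)
    (hR : ∀ t t' : ℝ, T₀ ≤ t → t ≤ t' → |R t' - R t| ≤ L * (t' - t)) (H r : ℝ) : ¬ RefPinR H r R := by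
  refine not_refPinR_of_slow (c := 1) (fun K ↦ ?_) H r
  have hh0 : (0 : ℝ) < 1 / (L + 1) := by positivity
  have hh1 : 1 / (L + 1) ≤ 1 := by rw [div_le_one (by positivity)]; linarith
  refine ⟨max (max K T₀) (Real.exp ((L + 1) * Real.exp K)), 1 / (L + 1), ?_, hh0.le, hh1, ?_, ?_⟩
  · exact (le_max_left _ _).trans (le_max_left _ _)
  · set T := max (max K T₀) (Real.exp ((L + 1) * Real.exp K))
    have hT : Real.exp ((L + 1) * Real.exp K) ≤ T := le_max_right _ _
    have hTpos : 0 < T := (Real.exp_pos _).trans_le hT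
    have hlogT : (L + 1) * Real.exp K ≤ Real.log T := by
      rw [Real.le_log_iff_exp_le hTpos]; exact hT
    have h1 : Real.exp K ≤ 1 / (L + 1) * Real.log T := by
      rw [one_div, ← div_eq_inv_mul, le_div_iff₀ (by positivity)]
      linarith
    calc K = Real.log (Real.exp K) := (Real.log_exp K).symm
      _ ≤ Real.log (3 + 1 / (L + 1) * Real.log T) :=
          Real.log_le_log (Real.exp_pos K) (by linarith)
  · intro t ht
    have hT₀t : T₀ ≤ t := le_trans ((le_max_right _ _).trans (le_max_left _ _)) ht.1
    calc |R (t + 1 / (L + 1)) - R t| ≤ L * (t + 1 / (L + 1) - t) := hR t _ hT₀t (by linarith)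
      _ = L / (L + 1) := by ring
      _ ≤ 1 := by rw [div_le_one (by positivity)]; linarith

/-- **E4 at the unit scale.**  `S(t+1) − S(t)` (the zero count of a unit window minus its mean) has mean square
`π⁻² T log(3 + log T) → ∞ · T` on `[T, 2T]`; hence NO reference with eventually BOUNDED UNIT INCREMENTS pins `S`, at any radius,
above any height — whatever its amplitude, sign pattern or rate of growth. -/
theorem not_refPinR_of_bounded_unit_incr {R : ℝ → ℝ} {c T₀ : ℝ}
    (hR : ∀ t : ℝ, T₀ ≤ t → |R (t + 1) - R t| ≤ c) (H r : ℝ) : ¬ RefPinR H r R := by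
  refine not_refPinR_of_slow (c := c) (fun K ↦ ?_) H r
  refine ⟨max (max K T₀) (Real.exp (Real.exp K)), 1, (le_max_left _ _).trans (le_max_left _ _), zero_le_one,
    le_rfl, ?_, fun t ht ↦ hR t (le_trans ((le_max_right _ _).trans (le_max_left _ _)) ht.1)⟩
  set T := max (max K T₀) (Real.exp (Real.exp K))
  have hT : Real.exp (Real.exp K) ≤ T := le_max_right _ _
  have hTpos : 0 < T := (Real.exp_pos _).trans_le hT
  have hlogT : Real.exp K ≤ Real.log T := by rw [Real.le_log_iff_exp_le hTpos]; exact hT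
  calc K = Real.log (Real.exp K) := (Real.log_exp K).symm
    _ ≤ Real.log (3 + 1 * Real.log T) := Real.log_le_log (Real.exp_pos K) (by linarith)

/-! ## §5 Amplitude-modulated oscillations `A(t) · sin t` with `A = o(log)`: outside every g10 engine, killed by E4 -/

/-- **E4 for modulated oscillations.**  Let `R(t) = A(t) · sin t` where the amplitude has unit-scale increments `≤ 1` beyond `T₀`
and is `o(log T)` on late windows in the quantified form `∀ K, ∃ T ≥ K, ∃ M ≥ 1, |A| ≤ M on [T, 2T+1] ∧ e^K · M ≤ log T`.  Then `R`
pins `S` at no radius above no height (scale `h = 1/M`: increments `≤ 2`, `h log T ≥ e^K`).  Instances below: `A = √log`,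
`A = log^{1/3}` — two-signed, unbounded above and below, amplitude at or above Selberg's `Ω` rate, so no g10 engine applies. -/
theorem not_refPinR_amp_mul_sin {A : ℝ → ℝ} {T₀ : ℝ}
    (hA1 : ∀ t h : ℝ, T₀ ≤ t → 0 ≤ h → h ≤ 1 → |A (t + h) - A t| ≤ 1)
    (hA2 : ∀ K : ℝ, ∃ T M : ℝ, K ≤ T ∧ 1 ≤ M ∧ (∀ t ∈ Icc T (2 * T + 1), |A t| ≤ M) ∧
      Real.exp K * M ≤ Real.log T) (H r : ℝ) :
    ¬ RefPinR H r fun t ↦ A t * Real.sin t := by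
  refine not_refPinR_of_slow (c := 2) (fun K ↦ ?_) H r
  obtain ⟨T, M, hKT, hM1, hAM, hKM⟩ := hA2 (max K T₀)
  have hTK : K ≤ T := (le_max_left _ _).trans hKT
  have hT₀ : T₀ ≤ T := (le_max_right _ _).trans hKT
  have hMpos : 0 < M := by linarith
  have hEK : 0 < Real.exp K := Real.exp_pos K
  have hh0 : 0 < 1 / M := by positivity
  have hh1 : 1 / M ≤ 1 := by rw [div_le_one hMpos]; exact hM1
  refine ⟨T, 1 / M, hTK, hh0.le, hh1, ?_, ?_⟩
  · have h1 : Real.exp K * M ≤ Real.log T :=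
      le_trans (mul_le_mul_of_nonneg_right (Real.exp_le_exp.2 (le_max_left K T₀)) hMpos.le) hKM
    have h2 : Real.exp K ≤ 1 / M * Real.log T := by
      rw [one_div, inv_mul_eq_div, le_div_iff₀ hMpos]; exact h1
    calc K = Real.log (Real.exp K) := (Real.log_exp K).symm
      _ ≤ Real.log (3 + 1 / M * Real.log T) := Real.log_le_log hEK (by linarith)
  · intro t ht
    set h : ℝ := 1 / M with hhdef
    have e : A (t + h) * Real.sin (t + h) - A t * Real.sin t =
        (A (t + h) - A t) * Real.sin (t + h) + A t * (Real.sin (t + h) - Real.sin t) := by ring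
    rw [e]
    have h1 : |(A (t + h) - A t) * Real.sin (t + h)| ≤ 1 := by
      rw [abs_mul]
      calc |A (t + h) - A t| * |Real.sin (t + h)| ≤ 1 * 1 :=
            mul_le_mul (hA1 t h (hT₀.trans ht.1) hh0.le hh1) (Real.abs_sin_le_one _) (abs_nonneg _) zero_le_one
        _ = 1 := one_mul 1
    have h2 : |A t * (Real.sin (t + h) - Real.sin t)| ≤ M * h := by
      rw [abs_mul]
      refine mul_le_mul (hAM t ⟨ht.1, by linarith [ht.2]⟩) ?_ (abs_nonneg _) hMpos.le
      calc |Real.sin (t + h) - Real.sin t| ≤ |t + h - t| := Real.abs_sin_sub_sin_le _ _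
        _ = h := by rw [add_sub_cancel_left, abs_of_nonneg hh0.le]
    calc _ ≤ |(A (t + h) - A t) * Real.sin (t + h)| + |A t * (Real.sin (t + h) - Real.sin t)| := abs_add_le _ _
      _ ≤ 1 + M * h := add_le_add h1 h2
      _ = 2 := by rw [hhdef, mul_one_div_cancel hMpos.ne']; norm_num

/-- `log (t + h) ≤ log t + 1` for `t ≥ 1`, `0 ≤ h ≤ 1`. -/
theorem log_add_le {t h : ℝ} (ht : 1 ≤ t) (hh : 0 ≤ h) (hh1 : h ≤ 1) :
    Real.log (t + h) ≤ Real.log t + 1 := by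
  have ht0 : 0 < t := by linarith
  have he : 2 < Real.exp 1 := by
    have := Real.exp_one_gt_d9; linarith
  calc Real.log (t + h) ≤ Real.log (Real.exp 1 * t) :=
        Real.log_le_log (by linarith) (by nlinarith)
    _ = Real.log t + 1 := by
        rw [Real.log_mul (Real.exp_pos 1).ne' ht0.ne', Real.log_exp]; ring

/-- `log (2T + 1) ≤ 2 log T` for `T ≥ 3`. -/
theorem log_two_mul_add_one_le {T : ℝ} (hT : 3 ≤ T) : Real.log (2 * T + 1) ≤ 2 * Real.log T := by
  have hsq : 2 * T + 1 ≤ T ^ 2 := by nlinarith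
  calc Real.log (2 * T + 1) ≤ Real.log (T ^ 2) := Real.log_le_log (by linarith) hsq
    _ = 2 * Real.log T := by rw [Real.log_pow]; push_cast; ring

/-- **`√(log t) · sin t` pins `S` at no radius above no height** (amplitude above Selberg's `Ω` rate; E4 at scale
`h_T = 1/√(log (2T+1))`). -/
theorem not_refPinR_sqrtLog_sin (H r : ℝ) :
    ¬ RefPinR H r fun t ↦ Real.sqrt (Real.log t) * Real.sin t := by
  refine not_refPinR_amp_mul_sin (T₀ := 1) (fun t h ht hh hh1 ↦ ?_) (fun K ↦ ?_) H r
  · -- unit-scale increments of `√log`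
    have hlog0 : 0 ≤ Real.log t := Real.log_nonneg ht
    have hs : Real.sqrt (Real.log t) ^ 2 = Real.log t := Real.sq_sqrt hlog0
    have h1 : Real.log t + 1 ≤ (Real.sqrt (Real.log t) + 1) ^ 2 := by
      nlinarith [Real.sqrt_nonneg (Real.log t), hs]
    have hup : Real.sqrt (Real.log (t + h)) ≤ Real.sqrt (Real.log t) + 1 :=
      calc Real.sqrt (Real.log (t + h)) ≤ Real.sqrt (Real.log t + 1) := Real.sqrt_le_sqrt (log_add_le ht hh hh1)
        _ ≤ Real.sqrt ((Real.sqrt (Real.log t) + 1) ^ 2) := Real.sqrt_le_sqrt h1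
        _ = Real.sqrt (Real.log t) + 1 := Real.sqrt_sq (by positivity)
    have hmono : Real.sqrt (Real.log t) ≤ Real.sqrt (Real.log (t + h)) :=
      Real.sqrt_le_sqrt (Real.log_le_log (by linarith) (by linarith))
    rw [abs_of_nonneg (by linarith)]
    linarith
  · -- growth: `M = √(log (2T+1))`, `e^K · M ≤ log T` once `log T ≥ 2 e^{2K} + 2`
    set T : ℝ := max (max K 3) (Real.exp (2 * Real.exp K ^ 2 + 2)) with hTdef
    have hT3 : 3 ≤ T := (le_max_right _ _).trans (le_max_left _ _)
    have hTK : K ≤ T := (le_max_left _ _).trans (le_max_left _ _)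
    have hTe : Real.exp (2 * Real.exp K ^ 2 + 2) ≤ T := le_max_right _ _
    have hTpos : 0 < T := by linarith
    have hEK : 0 < Real.exp K := Real.exp_pos K
    have hlogT : 2 * Real.exp K ^ 2 + 2 ≤ Real.log T := by
      rw [Real.le_log_iff_exp_le hTpos]; exact hTe
    have hlogT2 : 2 ≤ Real.log T := by nlinarith [sq_nonneg (Real.exp K)]
    set M : ℝ := Real.sqrt (Real.log (2 * T + 1)) with hMdef
    have hlog2T1 : Real.log T ≤ Real.log (2 * T + 1) := Real.log_le_log hTpos (by linarith)
    have hM1 : 1 ≤ M := by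
      calc (1 : ℝ) = Real.sqrt 1 := Real.sqrt_one.symm
        _ ≤ M := by rw [hMdef]; exact Real.sqrt_le_sqrt (by linarith)
    have hMpos : 0 < M := by linarith
    refine ⟨T, M, hTK, hM1, fun t ht ↦ ?_, ?_⟩
    · rw [abs_of_nonneg (Real.sqrt_nonneg _), hMdef]
      exact Real.sqrt_le_sqrt (Real.log_le_log (by linarith [ht.1]) (by linarith [ht.2]))
    · have hM2 : M ^ 2 ≤ 2 * Real.log T := by
        rw [hMdef, Real.sq_sqrt (by linarith)]; exact log_two_mul_add_one_le hT3
      have h5 : (Real.exp K * M) ^ 2 ≤ Real.log T ^ 2 := by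
        calc (Real.exp K * M) ^ 2 = Real.exp K ^ 2 * M ^ 2 := by ring
          _ ≤ Real.exp K ^ 2 * (2 * Real.log T) := mul_le_mul_of_nonneg_left hM2 (sq_nonneg _)
          _ = (2 * Real.exp K ^ 2) * Real.log T := by ring
          _ ≤ Real.log T * Real.log T := mul_le_mul_of_nonneg_right (by linarith) (by linarith)
          _ = Real.log T ^ 2 := by ring
      nlinarith [h5, hEK, hMpos]

/-- `(a + 1)^{1/3} ≤ a^{1/3} + 1` for `a ≥ 0`. -/
theorem rpow_third_add_one_le {a : ℝ} (ha : 0 ≤ a) :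
    (a + 1) ^ (1 / 3 : ℝ) ≤ a ^ (1 / 3 : ℝ) + 1 := by
  have e3 : (1 / 3 : ℝ) = ((3 : ℕ) : ℝ)⁻¹ := by norm_num
  set b : ℝ := a ^ (1 / 3 : ℝ) with hb
  have hb0 : 0 ≤ b := Real.rpow_nonneg ha _
  have hb3 : b ^ 3 = a := by rw [hb, e3]; exact Real.rpow_inv_natCast_pow ha three_ne_zero
  have h1 : a + 1 ≤ (b + 1) ^ 3 := by nlinarith [sq_nonneg b]
  calc (a + 1) ^ (1 / 3 : ℝ) ≤ ((b + 1) ^ 3) ^ (1 / 3 : ℝ) :=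
        Real.rpow_le_rpow (by linarith) h1 (by norm_num)
    _ = b + 1 := by rw [e3]; exact Real.pow_rpow_inv_natCast (by linarith) three_ne_zero

/-- **`(log t)^{1/3} · sin t` pins `S` at no radius above no height** — the oscillating two-signed instance `RefPinOscH0` that the
g10 card flagged «no kernel refutation applies» (amplitude exactly at the `(log t)^{1/3}` scale of Selberg's `Ω` theorem); E4 at
scale `h_T = (log (2T+1))^{-1/3}`. -/
theorem not_refPinR_cbrtLog_sin (H r : ℝ) :
    ¬ RefPinR H r fun t ↦ Real.log t ^ (1 / 3 : ℝ) * Real.sin t := by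
  have e3 : (1 / 3 : ℝ) = ((3 : ℕ) : ℝ)⁻¹ := by norm_num
  refine not_refPinR_amp_mul_sin (T₀ := 1) (fun t h ht hh hh1 ↦ ?_) (fun K ↦ ?_) H r
  · have hlog0 : 0 ≤ Real.log t := Real.log_nonneg ht
    have hup : Real.log (t + h) ^ (1 / 3 : ℝ) ≤ Real.log t ^ (1 / 3 : ℝ) + 1 :=
      calc Real.log (t + h) ^ (1 / 3 : ℝ) ≤ (Real.log t + 1) ^ (1 / 3 : ℝ) :=
            Real.rpow_le_rpow (Real.log_nonneg (by linarith)) (log_add_le ht hh hh1) (by norm_num)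
        _ ≤ Real.log t ^ (1 / 3 : ℝ) + 1 := rpow_third_add_one_le hlog0
    have hmono : Real.log t ^ (1 / 3 : ℝ) ≤ Real.log (t + h) ^ (1 / 3 : ℝ) :=
      Real.rpow_le_rpow hlog0 (Real.log_le_log (by linarith) (by linarith)) (by norm_num)
    rw [abs_of_nonneg (by linarith)]
    linarith
  · set T : ℝ := max (max K 3) (Real.exp (2 * Real.exp K ^ 3 + 2)) with hTdef
    have hT3 : 3 ≤ T := (le_max_right _ _).trans (le_max_left _ _)
    have hTK : K ≤ T := (le_max_left _ _).trans (le_max_left _ _)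
    have hTe : Real.exp (2 * Real.exp K ^ 3 + 2) ≤ T := le_max_right _ _
    have hTpos : 0 < T := by linarith
    have hEK : 0 < Real.exp K := Real.exp_pos K
    have hlogT : 2 * Real.exp K ^ 3 + 2 ≤ Real.log T := by
      rw [Real.le_log_iff_exp_le hTpos]; exact hTe
    have hlogT2 : 2 ≤ Real.log T := by nlinarith [pow_pos hEK 3]
    have hl0 : 0 ≤ Real.log (2 * T + 1) := Real.log_nonneg (by linarith)
    set M : ℝ := Real.log (2 * T + 1) ^ (1 / 3 : ℝ) with hMdef
    have hlog2T1 : Real.log T ≤ Real.log (2 * T + 1) := Real.log_le_log hTpos (by linarith)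
    have hM1 : 1 ≤ M := Real.one_le_rpow (by linarith) (by norm_num)
    have hMpos : 0 < M := by linarith
    have hM3 : M ^ 3 = Real.log (2 * T + 1) := by
      rw [hMdef, e3]; exact Real.rpow_inv_natCast_pow hl0 three_ne_zero
    refine ⟨T, M, hTK, hM1, fun t ht ↦ ?_, ?_⟩
    · rw [abs_of_nonneg (Real.rpow_nonneg (Real.log_nonneg (by linarith [ht.1])) _), hMdef]
      exact Real.rpow_le_rpow (Real.log_nonneg (by linarith [ht.1]))
        (Real.log_le_log (by linarith [ht.1]) (by linarith [ht.2])) (by norm_num)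
    · have hM3' : M ^ 3 ≤ 2 * Real.log T := hM3 ▸ log_two_mul_add_one_le hT3
      have h5 : (Real.exp K * M) ^ 3 ≤ Real.log T ^ 3 := by
        calc (Real.exp K * M) ^ 3 = Real.exp K ^ 3 * M ^ 3 := by ring
          _ ≤ Real.exp K ^ 3 * (2 * Real.log T) := mul_le_mul_of_nonneg_left hM3' (pow_nonneg hEK.le 3)
          _ = (2 * Real.exp K ^ 3) * Real.log T := by ring
          _ ≤ Real.log T ^ 2 * Real.log T := by
              refine mul_le_mul_of_nonneg_right ?_ (by linarith)
              nlinarith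
          _ = Real.log T ^ 3 := by ring
      exact le_of_pow_le_pow_left₀ three_ne_zero (by linarith) h5

/-! ## §6 Read-backs for the radius-1 pin `RefPin H R` (`|S − R| < 1` above `H`; N66/N67 of the card) -/

/-- `RefPin` is `RefPinR` at radius `1` (definitional). -/
theorem refPinR_one_iff {H : ℝ} {R : ℝ → ℝ} : RefPinR H 1 R ↔ RefPin H R := Iff.rfl

/-- E4 for `RefPin`: slowly varying at one admissible scale ⇒ no pin. -/
theorem not_refPin_of_slow {R : ℝ → ℝ} {c : ℝ}
    (hslow : ∀ K : ℝ, ∃ T h : ℝ, K ≤ T ∧ 0 ≤ h ∧ h ≤ 1 ∧ K ≤ Real.log (3 + h * Real.log T) ∧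
      ∀ t ∈ Icc T (2 * T), |R (t + h) - R t| ≤ c) (H : ℝ) : ¬ RefPin H R :=
  fun h ↦ not_refPinR_of_slow hslow H 1 (refPinR_one_iff.2 h)

/-- E4 for `RefPin`: bounded unit increments ⇒ no pin. -/
theorem not_refPin_of_bounded_unit_incr {R : ℝ → ℝ} {c T₀ : ℝ}
    (hR : ∀ t : ℝ, T₀ ≤ t → |R (t + 1) - R t| ≤ c) (H : ℝ) : ¬ RefPin H R :=
  fun h ↦ not_refPinR_of_bounded_unit_incr hR H 1 (refPinR_one_iff.2 h)

/-- E4 for `RefPin`: eventually Lipschitz ⇒ no pin. -/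
theorem not_refPin_of_lipschitz {R : ℝ → ℝ} {L T₀ : ℝ} (hL : 0 ≤ L)
    (hR : ∀ t t' : ℝ, T₀ ≤ t → t ≤ t' → |R t' - R t| ≤ L * (t' - t)) (H : ℝ) : ¬ RefPin H R :=
  fun h ↦ not_refPinR_of_lipschitz hL hR H 1 (refPinR_one_iff.2 h)

/-- `√(log t) · sin t` is not a radius-1 reference for `S` above any height. -/
theorem not_refPin_sqrtLog_sin (H : ℝ) : ¬ RefPin H fun t ↦ Real.sqrt (Real.log t) * Real.sin t :=
  fun h ↦ not_refPinR_sqrtLog_sin H 1 (refPinR_one_iff.2 h)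

/-- `(log t)^{1/3} · sin t` is not a radius-1 reference for `S` above any height (decides the g11 BC7-probed `RefPinOscH0` at every
height: it is FALSE). -/
theorem not_refPin_cbrtLog_sin (H : ℝ) : ¬ RefPin H fun t ↦ Real.log t ^ (1 / 3 : ℝ) * Real.sin t :=
  fun h ↦ not_refPinR_cbrtLog_sin H 1 (refPinR_one_iff.2 h)

/-- Read-back at the certified height: the g11 BC7-probed statement `RefPinOscH0` (literally: above `H₀ = 3000175332800`,
`|S(t) − (log t)^{1/3} sin t| < 1`) is FALSE. -/
theorem not_refPinOsc_H0 :
    ¬ (∀ t : ℝ, (3000175332800 : ℝ) ≤ t → |zetaArgS t - Real.log t ^ (1 / 3 : ℝ) * Real.sin t| < 1) :=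
  not_refPin_cbrtLog_sin _

end Summit.RiemannHypothesis.RiemannHypothesis.Theorems.Splittings.ZdPrimePin
end
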